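import Mathlib
import Literature.NumberTheory.LFunctions.Zhang2022.TypedSection16B
import Literature.NumberTheory.LFunctions.Zhang2022.AppendixALemma161Typed
import HarnessLib

/-!
# Zhang (2022) §16 (16.13)–(16.16): the sub-leaves of record ⇒ (16.16) with its TWO-PIECE transmitted
# error `O(𝓛⁻¹ + (1+|L′(1,χ)|)³𝓛⁻⁴)` (RT-03 internal assembly `eq16_16R2_of_subleaves`)

Topic `Literature/NumberTheory/LFunctions/Zhang2022` (Landau–Siegel audit tree; verdict-neutral).
Y. Zhang, *Discrete mean estimates and the Landau–Siegel zero*, arXiv:2211.02515v1 (2022)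
[Zhang2022LandauSiegel] — **an unrefereed manuscript under adjudication**; the displays referred to are
CLAIM nodes of `Typed.Section16B`, stated not asserted; nothing here bears on Theorems 1–2 of the source.
ZHANG-L discharge lane (WP16, seat zl-w16-p4), zl-lead rulings R-15/R-17 (RT-03): the v19 binder `h16_16`
(the PRINTED (16.16), error `C𝓛⁻⁴`, rows G-L4t5-1/G-L4t5-2/G-d57-1: not transmitted by the printed route)
re-types one-for-one to the two-piece repaired (16.16) — `Eq16_16R` with its right-hand side NOT
max-merged:

> `‖𝒮₂ⱼ − 𝔞𝔢ⱼ(φ(D)/D)L′(1,χ)‖ ≤ C·(𝓛⁻¹ + (1+|L′(1,χ)|)³𝓛⁻⁴)`, `j = 1, 2`, for all large `D` under (A)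

(node decl `Typed.Section16B.Eq16_16R2`, filed by zl-w16-typer; in THIS file the statement is spelled
INLINE, verbatim, so that no new `def … : Prop` is introduced by a prover — R1). PROVED here, as pure
bookkeeping over the tree's own edges (theorems only; no definitions, no named facts):

* `step16_u042R2_of_repair` — `Σ_n b₁(n)ϖ₂ⱼ(n)/n = (𝔞𝔢ⱼ/𝔭)(φ(D)/D)L′(1,χ) + O(𝓛⁻¹ + (1+|L′|)³𝓛⁻⁴)` from
  (16.15) [`Eq16_15`, `O(𝓛⁻¹)`], the `𝔫(𝔮)`-removal [`Inline16_nsetRemovable`, `O(𝓛⁻¹)`], u040 and the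
  repaired u041 [`Typed.Section16B.sumLtT_eval_of_repair`, `O((1+|L′|)³𝓛⁻⁴)`] — exactly
  `Typed.Section16B.step16_u042R_of_repair` WITHOUT its final `max`-merge of the two error sizes;
* `eq16_16R2_of` — (16.13) + that + Lemma 16.1 ⇒ the two-piece (16.16): the algebra of
  `Typed.Section16B.eq16_16R_of` (exact splitting `calS2_sub_main_eq_of_eq16_13`, `|𝓜₂*(1−β_j)| ≤ 4 + C`,
  `|𝓜₂*(1−β_j) − 𝔭| ≤ C𝓛⁻⁸`, `|(𝔞𝔢ⱼ/𝔭)(φ/D)L′| ≤ 2E(1+|L′|)³`, `𝓛⁻⁸ ≤ 𝓛⁻⁴`);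
* `eq16_16R2_of_subleaves` — **the RT-03 internal assembly**: `Eq16_15 → Inline16_nsetRemovable →
  Step16_u040a → Step16_u040b → Step16_u041aR → Lemma162R →` (two-piece (16.16)), Lemma 16.1 being the
  tree theorem `AppendixA.lemma161_holds` and `Step16_u041bR` coming from `Lemma162R` by
  `step16_u041bR_of_u039R ∘ step16_u039R_of_lemma162R` (signature = wp16 planner sketch S1).

## References

* Y. Zhang, arXiv:2211.02515v1 (2022), §16 (16.13)–(16.16) pp. 93–95, tex L4580–L4673; App. A p. 105
  (Lemmas 16.1–16.2). [cite: Zhang2022LandauSiegel, §16 (16.16) p.95]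
-/

noncomputable section

open Complex Real
open Literature.NumberTheory.LFunctions.Zhang2022
open Literature.NumberTheory.LFunctions.Zhang2022.Skeleton
open Literature.NumberTheory.LFunctions.Zhang2022.Typed.Section16A

namespace Literature.NumberTheory.LFunctions.Zhang2022.Typed.Section16B

variable (c' : ℝ)

/-- Any real threshold on `𝓛 = log D` is met for all large `D`. [folklore] -/
private theorem exists_forall_le_ell_R2 (M : ℝ) : ∃ D₀ : ℕ, ∀ D : ℕ, D₀ ≤ D → M ≤ ell D := by
  refine ⟨⌈Real.exp M⌉₊ + 1, fun D hD => ?_⟩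
  have hD1 : (⌈Real.exp M⌉₊ : ℝ) + 1 ≤ D := by exact_mod_cast hD
  have hD0 : (0 : ℝ) < D := by linarith [Nat.le_ceil (Real.exp M), Real.exp_pos M]
  rw [ell, Real.le_log_iff_exp_le hD0]
  linarith [Nat.le_ceil (Real.exp M)]

open scoped Classical in
/-- **u042 with the two-piece error** (§16 p. 94, tex L4667, DAG `Z22:§16.u042` in the repaired chain):
`Σ_n b₁(n)ϖ₂ⱼ(n)/n = (𝔞𝔢ⱼ/𝔭)(φ(D)/D)L′(1,χ) + O(𝓛⁻¹ + (1+|L′(1,χ)|)³𝓛⁻⁴)` from (16.15), the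
`𝔫(𝔮)`-removal and the repaired smoothed-sum evaluation `sumLtT_eval_of_repair` — the three error terms
`C₁𝓛⁻¹`, `C₂𝓛⁻¹`, `|𝔢_j|C₀(1+|L′|)³𝓛⁻⁴` added WITHOUT merging (`step16_u042R_of_repair` minus its `max`).
[cite: Zhang2022LandauSiegel, §16 p.94 (u042)] -/
theorem step16_u042R2_of_repair (h15 : Eq16_15 c') (hrem : Inline16_nsetRemovable c')
    (h40a : Step16_u040a c') (h40b : Step16_u040b c') (h41a : Step16_u041aR c')
    (h41b : Step16_u041bR c') :
    ∃ C : ℝ, ForAllLarge fun D _ χ => AssumptionA D χ → ∀ j ∈ ({1, 2} : Finset ℕ),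
      ‖(∑ n ∈ Finset.Ico 1 ⌈bigP D⌉₊, b1coef c' χ n * varpi2 c' χ j n / (n : ℂ)) -
          (frakA χ : ℂ) * frake j / frakp χ * ((Nat.totient D : ℂ) / (D : ℂ)) *
            deriv χ.LFunction 1‖ ≤
        C * ((ell D)⁻¹ + (1 + ‖deriv χ.LFunction 1‖) ^ 3 * (ell D ^ 4)⁻¹) := by
  obtain ⟨C₁, D₁, h₁⟩ := h15
  obtain ⟨C₂, D₂, h₂⟩ := hrem
  obtain ⟨C₀, D₀, h₀⟩ := sumLtT_eval_of_repair c' h40a h40b h41a h41b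
  obtain ⟨D₃, hD₃⟩ := exists_forall_le_ell_R2 1
  set E : ℝ := ‖frake 1‖ + ‖frake 2‖ with hE
  refine ⟨max C₁ 0 + max C₂ 0 + E * max C₀ 0,
    max (max D₁ D₂) (max D₀ D₃), fun D _ χ hD hq hp hA j hj => ?_⟩
  have hD₁ : D₁ ≤ D := le_trans (le_trans (le_max_left _ _) (le_max_left _ _)) hD
  have hD₂ : D₂ ≤ D := le_trans (le_trans (le_max_right _ _) (le_max_left _ _)) hD
  have hD₀ : D₀ ≤ D := le_trans (le_trans (le_max_left _ _) (le_max_right _ _)) hD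
  have hℓ1 : (1 : ℝ) ≤ ell D := hD₃ D (le_trans (le_trans (le_max_right _ _) (le_max_right _ _)) hD)
  have hℓ0 : 0 < ell D := by linarith
  have hinv0 : 0 ≤ (ell D)⁻¹ := inv_nonneg.mpr hℓ0.le
  have e₁ := h₁ D χ hD₁ hq hp hA j hj
  have e₂ := h₂ D χ hD₂ hq hp hA j hj
  have e₀ := h₀ D χ hD₀ hq hp hA j hj
  have hEj : ‖frake j‖ ≤ E := norm_frake_le_of_mem hj
  set x : ℝ := ‖deriv χ.LFunction 1‖ with hx
  have hx0 : 0 ≤ x := norm_nonneg _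
  set Y : ℝ := (1 + x) ^ 3 * (ell D ^ 4)⁻¹ with hY
  have hY0 : 0 ≤ Y := by positivity
  -- abbreviations
  set A := ∑ n ∈ Finset.Ico 1 ⌈bigP D⌉₊, b1coef c' χ n * varpi2 c' χ j n / (n : ℂ) with hA'
  set F := ∑ n₁ ∈ (Finset.Ico 1 ⌈bigT D⌉₊).filter (fun n₁ => n₁ ∈ nset (frakq D)),
    varpi2 c' χ j n₁ * nuConvChi χ n₁ / (n₁ : ℂ) with hF
  set S := ∑ n ∈ Finset.Ico 1 ⌈bigT D⌉₊, varpi2 c' χ j n * nuConvChi χ n / (n : ℂ) with hS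
  set M := (frakA χ : ℂ) / frakp χ * ((Nat.totient D : ℂ) / (D : ℂ)) * deriv χ.LFunction 1 with hM
  have hmain : (frakA χ : ℂ) * frake j / frakp χ * ((Nat.totient D : ℂ) / (D : ℂ)) *
      deriv χ.LFunction 1 = frake j * M := by rw [hM]; ring
  rw [hmain]
  have hsplit : A - frake j * M = (A - frake j * F) + (frake j * F - frake j * S) +
      frake j * (S - M) := by ring
  have e₀' : ‖S - M‖ ≤ max C₀ 0 * Y := by
    refine le_trans e₀ ?_
    calc C₀ * (1 + x) ^ 3 * (ell D ^ 4)⁻¹ ≤ max C₀ 0 * (1 + x) ^ 3 * (ell D ^ 4)⁻¹ :=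
          mul_le_mul_of_nonneg_right (mul_le_mul_of_nonneg_right (le_max_left _ _) (by positivity))
            (inv_nonneg.mpr (pow_nonneg hℓ0.le 4))
      _ = max C₀ 0 * Y := by rw [hY]; ring
  have t3 : ‖frake j * (S - M)‖ ≤ E * max C₀ 0 * Y := by
    rw [norm_mul]
    calc ‖frake j‖ * ‖S - M‖ ≤ E * (max C₀ 0 * Y) :=
          mul_le_mul hEj e₀' (norm_nonneg _) (le_trans (norm_nonneg _) hEj)
      _ = E * max C₀ 0 * Y := by ring
  have t1 : ‖A - frake j * F‖ ≤ max C₁ 0 * (ell D)⁻¹ :=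
    le_trans e₁ (mul_le_mul_of_nonneg_right (le_max_left _ _) hinv0)
  have t2 : ‖frake j * F - frake j * S‖ ≤ max C₂ 0 * (ell D)⁻¹ :=
    le_trans e₂ (mul_le_mul_of_nonneg_right (le_max_left _ _) hinv0)
  have hC₁0 : 0 ≤ max C₁ 0 := le_max_right _ _
  have hC₂0 : 0 ≤ max C₂ 0 := le_max_right _ _
  have hC₀0 : 0 ≤ max C₀ 0 := le_max_right _ _
  have hE0 : 0 ≤ E := le_trans (norm_nonneg _) hEj
  calc ‖A - frake j * M‖ = ‖(A - frake j * F) + (frake j * F - frake j * S) + frake j * (S - M)‖ := by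
        rw [hsplit]
    _ ≤ ‖A - frake j * F‖ + ‖frake j * F - frake j * S‖ + ‖frake j * (S - M)‖ := by
        have u1 : ‖(A - frake j * F) + (frake j * F - frake j * S)‖ ≤
            ‖A - frake j * F‖ + ‖frake j * F - frake j * S‖ := norm_add_le _ _
        have u2 := norm_add_le ((A - frake j * F) + (frake j * F - frake j * S)) (frake j * (S - M))
        linarith
    _ ≤ max C₁ 0 * (ell D)⁻¹ + max C₂ 0 * (ell D)⁻¹ + E * max C₀ 0 * Y := add_le_add (add_le_add t1 t2) t3
    _ ≤ (max C₁ 0 + max C₂ 0 + E * max C₀ 0) * ((ell D)⁻¹ + Y) := by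
        nlinarith [mul_nonneg hC₁0 hY0, mul_nonneg hC₂0 hY0, mul_nonneg (mul_nonneg hE0 hC₀0) hinv0]
    _ = (max C₁ 0 + max C₂ 0 + E * max C₀ 0) *
          ((ell D)⁻¹ + (1 + x) ^ 3 * (ell D ^ 4)⁻¹) := by rw [hY]

/-- **The two-piece (16.16) from (16.13), the two-piece u042 and Lemma 16.1** (§16 p. 95, tex L4670:
"Inserting this into (16.13) and applying Lemma 16.1 we obtain (16.16)"): the algebra of
`Typed.Section16B.eq16_16R_of` with the error kept in two pieces — by the exact splitting
`calS2_sub_main_eq_of_eq16_13`, `𝒮₂ⱼ − 𝔞𝔢ⱼ(φ/D)L′ = 𝓜₂*(1−β_j)·[Σ_n b₁ϖ₂ⱼ/n − (𝔞𝔢ⱼ/𝔭)(φ/D)L′] +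
(𝓜₂*(1−β_j) − 𝔭)·(𝔞𝔢ⱼ/𝔭)(φ/D)L′ + 0`, with `|𝓜₂*(1−β_j)| ≤ 4 + C` (`norm_frakp_le_four`, Lemma 16.1 at
`s = 1−β_j`, `|β_j| < 5α`), `|𝓜₂*(1−β_j) − 𝔭| ≤ C𝓛⁻⁸`, `|(𝔞𝔢ⱼ/𝔭)(φ/D)L′| ≤ 2E(1+|L′|)³` (`|𝔭| ≥ 1/2`,
`𝔞 ≤ |L′|²`) and `𝓛⁻⁸ ≤ 𝓛⁻⁴`. No upper bound for `L′(1,χ)` is used.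
[cite: Zhang2022LandauSiegel, §16 (16.16) p.95] -/
theorem eq16_16R2_of (h13 : Eq16_13 c')
    (h42 : ∃ C : ℝ, ForAllLarge fun D _ χ => AssumptionA D χ → ∀ j ∈ ({1, 2} : Finset ℕ),
      ‖(∑ n ∈ Finset.Ico 1 ⌈bigP D⌉₊, b1coef c' χ n * varpi2 c' χ j n / (n : ℂ)) -
          (frakA χ : ℂ) * frake j / frakp χ * ((Nat.totient D : ℂ) / (D : ℂ)) *
            deriv χ.LFunction 1‖ ≤
        C * ((ell D)⁻¹ + (1 + ‖deriv χ.LFunction 1‖) ^ 3 * (ell D ^ 4)⁻¹))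
    (h161 : Lemma161 c') :
    ∃ C : ℝ, ForAllLarge fun D _ χ => AssumptionA D χ → ∀ j ∈ ({1, 2} : Finset ℕ),
      ‖calS2 c' χ j - (frakA χ : ℂ) * frake j * ((Nat.totient D : ℂ) / (D : ℂ)) * deriv χ.LFunction 1‖ ≤
        C * ((ell D)⁻¹ + (1 + ‖deriv χ.LFunction 1‖) ^ 3 * (ell D ^ 4)⁻¹) := by
  obtain ⟨D₃, h₃⟩ := calS2_sub_main_eq_of_eq16_13 c' h13
  obtain ⟨C₄, D₄, h₄⟩ := h42
  obtain ⟨C_L, D_L, hL⟩ := h161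
  set E : ℝ := ‖frake 1‖ + ‖frake 2‖ with hE
  set L₀ : ℝ := max 3 (Real.pi * (5 * |c'| + 1)) with hL₀
  obtain ⟨D₅, hD₅⟩ := exists_forall_le_ell_R2 L₀
  refine ⟨(4 + max C_L 0) * max C₄ 0 + max C_L 0 * (2 * E),
    max (max D₃ D₄) (max D_L D₅), fun D _ χ hD hq hp hA j hj => ?_⟩
  have hD₃ : D₃ ≤ D := le_trans (le_trans (le_max_left _ _) (le_max_left _ _)) hD
  have hD₄ : D₄ ≤ D := le_trans (le_trans (le_max_right _ _) (le_max_left _ _)) hD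
  have hD_L : D_L ≤ D := le_trans (le_trans (le_max_left _ _) (le_max_right _ _)) hD
  have hℓL₀ : L₀ ≤ ell D := hD₅ D (le_trans (le_trans (le_max_right _ _) (le_max_right _ _)) hD)
  have hℓ3 : 3 ≤ ell D := le_trans (le_max_left _ _) hℓL₀
  have hℓπ : Real.pi * (5 * |c'| + 1) ≤ ell D := le_trans (le_max_right _ _) hℓL₀
  have hℓ2 : 2 ≤ ell D := by linarith
  have hℓ1 : 1 ≤ ell D := by linarith
  have hℓ0 : 0 < ell D := by linarith
  have hinv0 : 0 ≤ (ell D)⁻¹ := inv_nonneg.mpr hℓ0.le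
  -- the inputs at this `D`, `χ`, `j`
  have eId := h₃ D χ hD₃ hq hp hA j hj
  have e42 := h₄ D χ hD₄ hq hp hA j hj
  -- Lemma 16.1 at `s = 1 − β_j`, `d = l = 1`
  have hdl : ((1 * 1 : ℕ) : ℝ) < bigP D / bigT D ^ 2 := by
    have hT : 0 < bigT D ^ 2 := pow_pos (Real.exp_pos _) 2
    rw [Nat.cast_mul, Nat.cast_one, mul_one, lt_div_iff₀ hT, one_mul]
    exact bigT_sq_lt_bigP hℓ2
  have hs : ‖(1 - betaJ c' D j) - 1‖ < 5 * alpha D := by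
    rw [sub_sub_cancel_left, norm_neg]
    exact norm_betaJ_lt_five_alpha hℓ2 hℓπ hj
  have e161 : ‖calM2star c' χ (1 - betaJ c' D j) - frakp χ‖ ≤ C_L * (ell D ^ 8)⁻¹ :=
    hL D χ hD_L hq hp hA 1 1 le_rfl le_rfl hdl (1 - betaJ c' D j) hs
  -- sizes
  have hp4 := norm_frakp_le_four χ hq
  have hp2 := half_le_norm_frakp χ hq
  have hpne : frakp χ ≠ 0 := by
    intro h0
    rw [h0, norm_zero] at hp2
    norm_num at hp2
  have h8' : 0 ≤ (ell D ^ 8)⁻¹ := inv_nonneg.mpr (pow_nonneg hℓ0.le 8)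
  have h8 : (ell D ^ 8)⁻¹ ≤ 1 := inv_le_one_of_one_le₀ (one_le_pow₀ hℓ1)
  have h84 : (ell D ^ 8)⁻¹ ≤ (ell D ^ 4)⁻¹ :=
    inv_anti₀ (pow_pos hℓ0 4) (pow_le_pow_right₀ hℓ1 (by norm_num))
  have h40 : 0 ≤ (ell D ^ 4)⁻¹ := inv_nonneg.mpr (pow_nonneg hℓ0.le 4)
  have hMle : ‖calM2star c' χ (1 - betaJ c' D j)‖ ≤ 4 + max C_L 0 := by
    have htri : ‖calM2star c' χ (1 - betaJ c' D j)‖ ≤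
        ‖calM2star c' χ (1 - betaJ c' D j) - frakp χ‖ + ‖frakp χ‖ := norm_le_norm_sub_add _ _
    have : C_L * (ell D ^ 8)⁻¹ ≤ max C_L 0 := by
      calc C_L * (ell D ^ 8)⁻¹ ≤ max C_L 0 * (ell D ^ 8)⁻¹ :=
            mul_le_mul_of_nonneg_right (le_max_left _ _) h8'
        _ ≤ max C_L 0 * 1 := mul_le_mul_of_nonneg_left h8 (le_max_right _ _)
        _ = max C_L 0 := mul_one _
    linarith
  obtain ⟨hA0, hAle⟩ := frakA_nonneg_and_le_norm_sq χ
  have hEj : ‖frake j‖ ≤ E := norm_frake_le_of_mem hj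
  have hE0 : 0 ≤ E := le_trans (norm_nonneg _) hEj
  have hφ : ‖((Nat.totient D : ℂ) / (D : ℂ))‖ ≤ 1 := by
    rw [norm_div, Complex.norm_natCast, Complex.norm_natCast]
    have hD0 : (0 : ℝ) < D := by exact_mod_cast Nat.pos_of_ne_zero (NeZero.ne D)
    rw [div_le_one hD0]
    exact_mod_cast Nat.totient_le D
  set x : ℝ := ‖deriv χ.LFunction 1‖ with hx
  have hx0 : 0 ≤ x := norm_nonneg _
  set W : ℝ := (ell D)⁻¹ + (1 + x) ^ 3 * (ell D ^ 4)⁻¹ with hW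
  have hW0 : 0 ≤ W := by positivity
  -- the main-term size: `‖(𝔞𝔢ⱼ/𝔭)(φ/D)L′‖ ≤ 2E(1+x)³`
  set Mj := (frakA χ : ℂ) * frake j / frakp χ * ((Nat.totient D : ℂ) / (D : ℂ)) *
    deriv χ.LFunction 1 with hMj
  have hMj_le : ‖Mj‖ ≤ 2 * E * (1 + x) ^ 3 := by
    have h1 : ‖(frakA χ : ℂ) * frake j / frakp χ‖ ≤ x ^ 2 * E * 2 := by
      rw [norm_div, norm_mul, Complex.norm_real, Real.norm_of_nonneg hA0, div_le_iff₀ (by linarith)]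
      have : frakA χ * ‖frake j‖ ≤ x ^ 2 * E := mul_le_mul hAle hEj (norm_nonneg _) (sq_nonneg _)
      nlinarith [norm_nonneg (frake j), mul_nonneg hA0 (norm_nonneg (frake j)),
        mul_nonneg (sq_nonneg x) hE0]
    have hx3 : x ^ 2 * x ≤ (1 + x) ^ 3 := by nlinarith
    calc ‖Mj‖ = ‖(frakA χ : ℂ) * frake j / frakp χ‖ * ‖((Nat.totient D : ℂ) / (D : ℂ))‖ * x := by
          rw [hMj, norm_mul, norm_mul]
      _ ≤ (x ^ 2 * E * 2) * 1 * x := by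
          refine mul_le_mul_of_nonneg_right (mul_le_mul h1 hφ (norm_nonneg _) (by positivity)) hx0
      _ = 2 * E * (x ^ 2 * x) := by ring
      _ ≤ 2 * E * (1 + x) ^ 3 := mul_le_mul_of_nonneg_left hx3 (by positivity)
  -- assemble
  rw [eId]
  have hzero : frakp χ / frakp χ - 1 = 0 := by rw [div_self hpne, sub_self]
  rw [hzero, zero_mul, add_zero]
  have t1 : ‖calM2star c' χ (1 - betaJ c' D j) *
      ((∑ n ∈ Finset.Ico 1 ⌈bigP D⌉₊, b1coef c' χ n * varpi2 c' χ j n / (n : ℂ)) - Mj)‖ ≤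
      (4 + max C_L 0) * (max C₄ 0 * W) := by
    rw [norm_mul]
    refine mul_le_mul hMle (le_trans e42 ?_) (norm_nonneg _) (by positivity)
    exact mul_le_mul_of_nonneg_right (le_max_left _ _) hW0
  have t2 : ‖(calM2star c' χ (1 - betaJ c' D j) - frakp χ) * Mj‖ ≤
      max C_L 0 * (2 * E) * W := by
    rw [norm_mul]
    calc ‖calM2star c' χ (1 - betaJ c' D j) - frakp χ‖ * ‖Mj‖
        ≤ (max C_L 0 * (ell D ^ 8)⁻¹) * (2 * E * (1 + x) ^ 3) :=
          mul_le_mul (le_trans e161 (mul_le_mul_of_nonneg_right (le_max_left _ _) h8')) hMj_le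
            (norm_nonneg _) (by positivity)
      _ = max C_L 0 * (2 * E) * ((1 + x) ^ 3 * (ell D ^ 8)⁻¹) := by ring
      _ ≤ max C_L 0 * (2 * E) * ((1 + x) ^ 3 * (ell D ^ 4)⁻¹) :=
          mul_le_mul_of_nonneg_left (mul_le_mul_of_nonneg_left h84 (by positivity)) (by positivity)
      _ ≤ max C_L 0 * (2 * E) * W := by
          refine mul_le_mul_of_nonneg_left ?_ (by positivity)
          rw [hW]; linarith
  calc ‖calM2star c' χ (1 - betaJ c' D j) *
          ((∑ n ∈ Finset.Ico 1 ⌈bigP D⌉₊, b1coef c' χ n * varpi2 c' χ j n / (n : ℂ)) - Mj) +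
        (calM2star c' χ (1 - betaJ c' D j) - frakp χ) * Mj‖
      ≤ (4 + max C_L 0) * (max C₄ 0 * W) + max C_L 0 * (2 * E) * W :=
        le_trans (norm_add_le _ _) (add_le_add t1 t2)
    _ = ((4 + max C_L 0) * max C₄ 0 + max C_L 0 * (2 * E)) *
          ((ell D)⁻¹ + (1 + x) ^ 3 * (ell D ^ 4)⁻¹) := by rw [hW]; ring

/-- **RT-03 internal assembly** (zl-lead R-17; wp16 planner sketch S1, signature verbatim with the node
`Eq16_16R2` spelled inline): the typed sub-leaves of record under (16.16) — (16.15) `Eq16_15`, the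
`𝔫(𝔮)`-removal `Inline16_nsetRemovable`, u040 `Step16_u040a/b`, the repaired contour step `Step16_u041aR`
and the repaired Lemma 16.2 `Lemma162R` — imply (16.16) with the two-piece transmitted error
`O(𝓛⁻¹ + (1+|L′(1,χ)|)³𝓛⁻⁴)`. Lemma 16.1 is the tree theorem `AppendixA.lemma161_holds` ((16.13) follows from
it, `eq16_13_of_lemma161`); `Step16_u041bR ⇐ Lemma162R` is `step16_u041bR_of_u039R ∘
step16_u039R_of_lemma162R`. [cite: Zhang2022LandauSiegel, §16 (16.13)–(16.16) pp.93–95] -/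
theorem eq16_16R2_of_subleaves (h15 : Eq16_15 c') (hrem : Inline16_nsetRemovable c')
    (h40a : Step16_u040a c') (h40b : Step16_u040b c') (h41a : Step16_u041aR c')
    (h162 : Lemma162R c') :
    ∃ C : ℝ, ForAllLarge fun D _ χ => AssumptionA D χ → ∀ j ∈ ({1, 2} : Finset ℕ),
      ‖calS2 c' χ j - (frakA χ : ℂ) * frake j * ((Nat.totient D : ℂ) / (D : ℂ)) * deriv χ.LFunction 1‖ ≤
        C * ((ell D)⁻¹ + (1 + ‖deriv χ.LFunction 1‖) ^ 3 * (ell D ^ 4)⁻¹) :=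
  eq16_16R2_of c' (eq16_13_of_lemma161 c' (AppendixA.lemma161_holds c'))
    (step16_u042R2_of_repair c' h15 hrem h40a h40b h41a
      (step16_u041bR_of_u039R c' (step16_u039R_of_lemma162R c' h162)))
    (AppendixA.lemma161_holds c')

end Literature.NumberTheory.LFunctions.Zhang2022.Typed.Section16B

end
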